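import Summits.HubbardSuperconductivity.HubbardSuperconductivity.Theorems.KLProgrammeKLRegimeScaleZeroTadpoleNonvanishing
import Summits.HubbardSuperconductivity.HubbardSuperconductivity.Theorems.KLProgrammeKLRegimeEngineV8DefsU12bGQ
import Summits.HubbardSuperconductivity.HubbardSuperconductivity.Theorems.KLProgrammeKLRegimeEngineV8DefsL4

/-!
# Route `KLProgramme`, crux K3 — ENGINE (stmt-HubbardSuperconductivity-20437), row (C) credit path, GAP G-005 «(C)-TADPOLE-NONVANISHING»:
# the guarded Gfr-row of `hres′` IN THE BINDERS OF THE (C) CLOSER (`U ≤ klEngU₀12GQ G Q P R c`, `klEngL₄ P R β U ≤ L`)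

Seat hubbard-kl-k3c5-p1 (g19; writer of the G-005 owner lemma).  `…ScaleZeroTadpoleNonvanishing.hresGuard_gfr_row_klEng` is stated at
`U ≤ klEngU₀9 P R c`, `klEngL₃ β U ≤ L`; the closers of record (`…EngineV17F2ClosersCGQGuard{,Inst}`: `hres′` after `P.WF → R.WF2 → … →
U ≤ klEngU₀12GQ klEngGeo14 (klEngQ9dG klEngGeo14 P R) P R c → … → klEngL₄ P R β U ≤ L → klEngM₃ β U L ≤ M → … → HistP … 0 n`) read it
through the threshold chain `klEngU₀12GQ ≤ klEngU₀12G ≤ klEngU₀12 ≤ klEngU₀12Core ≤ klEngU₀9` and `klEngL₃_le_of_klEngL₄_le`: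
**`hresGuard_gfr_row_klEngGQ`** and **`exists_evalM_klFlowPiece_zero_ne_zero_klEngGQ`** — the conjunct `1 ≤ n → 0 < R.Gfr 0` of `hres′` and
G-005's `∃ q, evalM (klFlowPiece L M β U μ 0) q ≠ 0` with NO tadpole hypothesis, for EVERY `G`, `Q`.
Proofs only; no definitions; nothing here asserts (C), any stub of 20437, K3 or superconductivity.
References: BGM 2006 §3 (3.2)–(3.3) [cite: BenfattoGiulianiMastropietro2006].
-/

noncomputable section

namespace Summit.HubbardSuperconductivity.HubbardSuperconductivity.Theorems.KLRegimeSplit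

set_option linter.dupNamespace false -- summit = problem name (single-conjunct summit), D-0017

open Literature.MathematicalPhysics.QuantumLattice Literature.Probability.LatticeModels
open Summit.HubbardSuperconductivity.HubbardSuperconductivity.Theorems.EngineV8

variable {L M : ℕ} [NeZero L] [NeZero M] {μ U β : ℝ}

/-- The (C) closer's `U`-threshold is below the tail door's: `klEngU₀12GQ G Q P R c ≤ klEngU₀9 P R c`. [cite: BenfattoGiulianiMastropietro2006, §3 (3.2)] -/
theorem klEngU₀12GQ_le_klEngU₀9 (G : GeoConsts) (Q : EngConsts) (P : SplitConsts) (R : RenConsts) (c : ℝ) :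
    klEngU₀12GQ G Q P R c ≤ klEngU₀9 P R c :=
  (klEngU₀12GQ_le_klEngU₀12G G Q P R c).trans ((klEngU₀12G_le_klEngU₀12 G P R c).trans
    ((klEngU₀12_le_klEngU₀12Core P R c).trans (klEngU₀12Core_le_klEngU₀9 P R c)))

/-- **G-005 IN THE BINDERS OF THE (C) CLOSER**: for `R.WF2`, `μ ∈ klWindowC`, `0 < U ≤ klEngU₀12GQ G Q P R c`, `klBetaMin ≤ β`, `klEngL₄ P R β U ≤ L`,
`klEngM₃ β U L ≤ M`: `∃ q, evalM (klFlowPiece L M β U μ 0) q ≠ 0`. [cite: BenfattoGiulianiMastropietro2006, §3 (3.2)] -/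
theorem exists_evalM_klFlowPiece_zero_ne_zero_klEngGQ (G : GeoConsts) (Q : EngConsts) (P : SplitConsts) {R : RenConsts} (c : ℝ) (hR : R.WF2)
    (hμ : μ ∈ klWindowC) (hU : 0 < U) (hU12 : U ≤ klEngU₀12GQ G Q P R c) (hβ : klBetaMin ≤ β) (hL : klEngL₄ P R β U ≤ L)
    (hM : klEngM₃ β U L ≤ M) : ∃ q : Momentum, evalM (klFlowPiece L M β U μ 0) q ≠ 0 :=
  exists_evalM_klFlowPiece_zero_ne_zero_klEng (L := L) (M := M) P c hR hμ hU (hU12.trans (klEngU₀12GQ_le_klEngU₀9 G Q P R c)) hβ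
    (klEngL₃_le_of_klEngL₄_le hL) hM

/-- **THE GUARDED Gfr-ROW OF `hres′` IN THE BINDERS OF THE (C) CLOSER, NO TADPOLE HYPOTHESIS** (∘ ✓ p715417 `hresGuard_gfr_row_of_tadpole`):
for `R.WF2`, the dummy-frame history, `μ ∈ klWindowC`, `0 < U ≤ klEngU₀12GQ G Q P R c`, `klBetaMin ≤ β`, `klEngL₄ P R β U ≤ L`, `klEngM₃ β U L ≤ M`:
`1 ≤ n → 0 < R.Gfr 0`. [cite: BenfattoGiulianiMastropietro2006, §3 (3.2)-(3.3)] -/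
theorem hresGuard_gfr_row_klEngGQ {G : GeoConsts} (Q : EngConsts) (P : SplitConsts) {Q' : EngConsts} {R : RenConsts} (c : ℝ) {n : ℕ} (hR : R.WF2)
    (hhist : HistP klPredsV17F2 L M G P Q' R β U μ 0 n) (hμ : μ ∈ klWindowC) (hU : 0 < U) (hU12 : U ≤ klEngU₀12GQ G Q P R c)
    (hβ : klBetaMin ≤ β) (hL : klEngL₄ P R β U ≤ L) (hM : klEngM₃ β U L ≤ M) : 1 ≤ n → 0 < R.Gfr 0 :=
  hresGuard_gfr_row_of_tadpole hR hhist (exists_evalM_klFlowPiece_zero_ne_zero_klEngGQ (L := L) (M := M) G Q P c hR hμ hU hU12 hβ hL hM)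

end Summit.HubbardSuperconductivity.HubbardSuperconductivity.Theorems.KLRegimeSplit

end
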